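import Mathlib.Analysis.Calculus.FDeriv.Symmetric
import Literature.Analysis.FluidPDE.TsaiHeadPressure
import Literature.Analysis.FunctionSpaces.L2TemperedDistributionLaplacian
import HarnessLib

/-!
# The weak pressure–Poisson equation of a Leray profile (Tsai 1998, (2.1))

Analysis/FluidPDE support file (sixth of the chain discharging the named fact
`Literature.Analysis.FluidPDE.tsai1998_profile_smooth` of `TsaiGrowthLemmas`; T.-P. Tsai, *On
Leray's self-similar solutions of the Navier–Stokes equations satisfying local energy
estimates*, ARMA 143 (1998), p. 33: "By standard regularity theory of stationary Navier–Stokes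
equations, every weak solution `U` of (1.3) is actually smooth").

For the tree's pointwise profile class `IsLerayProfile ν a U P` on `ℝ^ι = EuclideanSpace ℝ ι`
(`U ∈ C²`, `P ∈ C¹`, `-νΔU + aU + a(y·∇)U + (U·∇)U + ∇P = 0`, `div U = 0`) the pressure is only
`C¹`, so the pressure–Poisson equation (Tsai 1998, (2.1): "We take the divergence of (1.3) and
formally deduce that `-ΔP = Σ ∂ᵢ∂ⱼ(UᵢUⱼ)`", which for `div U = 0` is `Σᵢⱼ ∂ᵢUⱼ ∂ⱼUᵢ`) holds
only in the weak sense. This file proves it in exactly that sense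
(`IsLerayProfile.integral_pressure_mul_laplacian`): for every smooth compactly supported
complex test function `ψ`,

  `∫ P Σᵢ ∂ᵢ∂ᵢψ = -∫ (Σᵢⱼ ∂ᵢUⱼ ∂ⱼUᵢ) ψ`.

Proof: one integration by parts gives `-Σᵢ ∫ ∂ᵢP ∂ᵢψ`; substitute
`∂ᵢP = ν Σⱼ∂ⱼ∂ⱼUᵢ - aUᵢ - Σⱼ(Uⱼ + a yⱼ)∂ⱼUᵢ` (the profile system in coordinates,
`IsLerayProfile.pderiv_pressure_eq` of `TsaiHeadPressure`); the viscous term is weakly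
divergence free (`sum_integral_laplacian_mul_fderiv_eq_zero`: two integrations by parts, Schwarz
for `ψ`, and `Σᵢ ∂ᵢ∂ⱼUᵢ = ∂ⱼ div U = 0`, `sum_pderiv_pderiv_comp_eq_zero'`), `div U = 0`,
`div ((y·∇)U) = div U + (y·∇) div U = 0` (`sum_pderiv_drift_eq_zero`) and
`div ((U·∇)U) = Σᵢⱼ ∂ᵢUⱼ ∂ⱼUᵢ` (`sum_pderiv_convect_eq`). The complex test functions (needed to
pair with Mathlib's `𝓢(E, ℂ)`-based tempered distributions downstream) are handled by
complexifying the real data (`contDiff_ofReal_comp`, `fderiv_ofReal_comp_stdVec`,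
`sum_integral_ofReal_mul_fderiv_eq`). Reference: T.-P. Tsai, ARMA 143 (1998) 29–51, (1.3),
(2.1), pp. 33–34 [Tsai1998].
-/

noncomputable section

open MeasureTheory
open scoped ENNReal ContDiff

namespace Literature.Analysis.FluidPDE

open Literature.Analysis.FunctionSpaces

variable {ι : Type*} [Fintype ι] [DecidableEq ι]

/-- Local notation for the Euclidean space `ℝ^ι`. -/
local notation "𝔼" => EuclideanSpace ℝ ι

/-! ### Complexified coordinate calculus -/

omit [DecidableEq ι] in
/-- Complexification preserves `C^n` regularity. [folklore] -/
theorem contDiff_ofReal_comp {n : WithTop ℕ∞} {u : 𝔼 → ℝ} (hu : ContDiff ℝ n u) :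
    ContDiff ℝ n (fun x => (u x : ℂ)) :=
  Complex.ofRealCLM.contDiff.comp hu

omit [DecidableEq ι] in
/-- The derivative of a complexified real function is the complexified derivative (the tree's
`TaoFourierSchur.fderiv_ofReal_comp_apply_pi` is the case `ι = Fin 3` behind heavy imports).
[folklore] -/
theorem fderiv_ofReal_comp_apply_pi {u : 𝔼 → ℝ} {x : 𝔼} (hu : DifferentiableAt ℝ u x) (v : 𝔼) :
    fderiv ℝ (fun y => (u y : ℂ)) x v = (fderiv ℝ u x v : ℂ) := by
  have h := (Complex.ofRealCLM.hasFDerivAt.comp x hu.hasFDerivAt).fderiv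
  rw [show (fun y => (u y : ℂ)) = (⇑Complex.ofRealCLM ∘ u) from rfl, h]
  rfl

/-- `∂ᵢ` of a complexified real function along the standard frame `EuclideanSpace.basisFun` is
the complexified coordinate partial derivative `pderiv i` of `CoordDerivatives`. [folklore] -/
theorem fderiv_ofReal_comp_stdVec {u : 𝔼 → ℝ} (hu : Differentiable ℝ u) (i : ι) :
    (fun x => fderiv ℝ (fun y => (u y : ℂ)) x (EuclideanSpace.basisFun ι ℝ i)) =
      fun x => (pderiv i u x : ℂ) := by
  funext x
  rw [fderiv_ofReal_comp_apply_pi (hu x), pderiv_apply]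
  congr 2
  simp [stdVec, EuclideanSpace.basisFun_apply]

/-- **Integration by parts of a real `C¹` vector field against a complex test function**:
`Σᵢ ∫ Gᵢ ∂ᵢψ = -∫ (div G) ψ` for `Gᵢ ∈ C¹` and `ψ ∈ C¹_c` (componentwise
`integral_mul_fderiv_apply_eq_neg`). [folklore] -/
theorem sum_integral_ofReal_mul_fderiv_eq {G : ι → 𝔼 → ℝ} (hG : ∀ i, ContDiff ℝ 1 (G i))
    {ψ : 𝔼 → ℂ} (hψ : ContDiff ℝ 1 ψ) (hψs : HasCompactSupport ψ) :
    ∑ i, ∫ x, (G i x : ℂ) * fderiv ℝ ψ x (EuclideanSpace.basisFun ι ℝ i) =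
      -∫ x, ((∑ i, pderiv i (G i) x : ℝ) : ℂ) * ψ x := by
  have hGd : ∀ i, Differentiable ℝ (G i) := fun i => (hG i).differentiable one_ne_zero
  have h1 : ∀ i, ∫ x, (G i x : ℂ) * fderiv ℝ ψ x (EuclideanSpace.basisFun ι ℝ i) =
      -∫ x, (pderiv i (G i) x : ℂ) * ψ x := by
    intro i
    rw [integral_mul_fderiv_apply_eq_neg (contDiff_ofReal_comp (hG i)) hψ hψs]
    congr 1
    refine integral_congr_ae (Filter.Eventually.of_forall fun x => ?_)
    have := congrFun (fderiv_ofReal_comp_stdVec (hGd i) i) x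
    simp only [this]
  have hI : ∀ i, Integrable (fun x => (pderiv i (G i) x : ℂ) * ψ x) (volume : Measure 𝔼) :=
    fun i => ((Complex.continuous_ofReal.comp (continuous_pderiv (hG i) one_ne_zero i)).mul
      hψ.continuous).integrable_of_hasCompactSupport hψs.mul_left
  simp_rw [h1]
  rw [Finset.sum_neg_distrib, ← integral_finsetSum _ fun i _ => hI i]
  congr 1
  refine integral_congr_ae (Filter.Eventually.of_forall fun x => ?_)
  simp [Finset.sum_mul]

/-- **Schwarz' theorem for `C²` functions** in coordinates: `∂ₖ∂ₗ f = ∂ₗ∂ₖ f` (Mathlib's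
`ContDiffAt.isSymmSndFDerivAt`; the tree's `pderiv_comm` asks `f ∈ C^∞`). [folklore] -/
theorem pderiv_comm_of_contDiff_two {f : 𝔼 → ℝ} (hf : ContDiff ℝ 2 f) (k l : ι) :
    pderiv k (pderiv l f) = pderiv l (pderiv k f) := by
  funext x
  have hd : DifferentiableAt ℝ (fderiv ℝ f) x :=
    ((hf.fderiv_right (m := 1) (by norm_num)).differentiable one_ne_zero) x
  have hsymm : IsSymmSndFDerivAt ℝ f x :=
    hf.contDiffAt.isSymmSndFDerivAt (by simp [minSmoothness_of_isRCLikeNormedField])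
  rw [pderiv_apply, pderiv_apply, pderiv_eq l, pderiv_eq k,
    fderiv_clm_apply hd (differentiableAt_const _), fderiv_clm_apply hd (differentiableAt_const _)]
  simp only [fderiv_fun_const, Pi.zero_apply, ContinuousLinearMap.comp_zero, zero_add,
    ContinuousLinearMap.flip_apply]
  exact hsymm _ _

omit [DecidableEq ι] in
/-- Schwarz' theorem for `C²` complex functions along two vectors. [folklore] -/
theorem fderiv_fderiv_comm_of_contDiff_two {ψ : 𝔼 → ℂ} (hψ : ContDiff ℝ 2 ψ) (v w : 𝔼) (x : 𝔼) :
    fderiv ℝ (fun y => fderiv ℝ ψ y v) x w = fderiv ℝ (fun y => fderiv ℝ ψ y w) x v := by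
  have hd : DifferentiableAt ℝ (fderiv ℝ ψ) x :=
    ((hψ.fderiv_right (m := 1) (by norm_num)).differentiable one_ne_zero) x
  have hsymm : IsSymmSndFDerivAt ℝ ψ x :=
    hψ.contDiffAt.isSymmSndFDerivAt (by simp [minSmoothness_of_isRCLikeNormedField])
  rw [fderiv_clm_apply hd (differentiableAt_const _), fderiv_clm_apply hd (differentiableAt_const _)]
  simp only [fderiv_fun_const, Pi.zero_apply, ContinuousLinearMap.comp_zero, zero_add,
    ContinuousLinearMap.flip_apply]
  exact hsymm _ _

/-- `∂ₗ f ∈ C¹` for `f ∈ C²`. [folklore] -/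
theorem contDiff_one_pderiv_of_contDiff_two {f : 𝔼 → ℝ} (hf : ContDiff ℝ 2 f) (l : ι) :
    ContDiff ℝ 1 (pderiv l f) :=
  (hf.fderiv_right (m := 1) (by norm_num)).clm_apply contDiff_const

/-- `Σᵢ ∂ᵢ∂ⱼUᵢ = ∂ⱼ(div U) = 0` for a Leray profile (Schwarz for `U ∈ C²` and `div U = 0`;
the tree's `IsLerayProfile.sum_pderiv_pderiv_comp_eq_zero` asks `U ∈ C^∞`). [cite: Tsai1998, (1.3)] -/
theorem IsLerayProfile.sum_pderiv_pderiv_comp_eq_zero' {ν a : ℝ} {U : 𝔼 → 𝔼} {P : 𝔼 → ℝ} (h : IsLerayProfile ν a U P) (j : ι)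
    (x : 𝔼) : ∑ i, pderiv i (pderiv j fun z => U z i) x = 0 := by
  have hUc : ∀ i, ContDiff ℝ 2 (fun z => U z i) := fun i =>
    contDiff_comp_euclidean h.contDiff_velocity i
  have e : ∀ i, pderiv i (pderiv j fun z => U z i) = pderiv j (pderiv i fun z => U z i) :=
    fun i => pderiv_comm_of_contDiff_two (hUc i) i j
  simp_rw [e]
  have hd : ∀ i, Differentiable ℝ (pderiv i fun z => U z i) := fun i =>
    (contDiff_one_pderiv_of_contDiff_two (hUc i) i).differentiable one_ne_zero
  have hs := congrFun (pderiv_sum Finset.univ (f := fun i => pderiv i fun z => U z i)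
    (fun i _ => hd i) j) x
  simp only at hs
  rw [← hs]
  have hz : (fun x => ∑ i, pderiv i (fun z => U z i) x) = fun _ => (0 : ℝ) :=
    funext h.sum_pderiv_comp_eq_zero
  rw [hz, pderiv_const]

/-- The drift `(y·∇)U` of a Leray profile is divergence free:
`Σᵢ ∂ᵢ(Σⱼ yⱼ ∂ⱼUᵢ) = div U + (y·∇) div U = 0` (Tsai 1998, p. 34: the terms `aU + a(y·∇)U`
drop out of the divergence of (1.3), giving (2.1)). [cite: Tsai1998, (2.1)] -/
theorem IsLerayProfile.sum_pderiv_drift_eq_zero {ν a : ℝ} {U : 𝔼 → 𝔼} {P : 𝔼 → ℝ} (h : IsLerayProfile ν a U P) (x : 𝔼) :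
    ∑ i, pderiv i (fun y => ∑ j, y j * pderiv j (fun z => U z i) y) x = 0 := by
  have hUc : ∀ i, ContDiff ℝ 2 (fun z => U z i) := fun i =>
    contDiff_comp_euclidean h.contDiff_velocity i
  have hd : ∀ i j, Differentiable ℝ (pderiv j fun z => U z i) := fun i j =>
    (contDiff_one_pderiv_of_contDiff_two (hUc i) j).differentiable one_ne_zero
  have hterm : ∀ i, pderiv i (fun y => ∑ j, y j * pderiv j (fun z => U z i) y) x =
      pderiv i (fun z => U z i) x + ∑ j, x j * pderiv i (pderiv j fun z => U z i) x := by
    intro i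
    rw [pderiv_sum Finset.univ (f := fun j y => y j * pderiv j (fun z => U z i) y)
      fun j _ => (differentiable_euclideanCoord j).mul (hd i j)]
    have e : ∀ j, pderiv i (fun y => y j * pderiv j (fun z => U z i) y) x =
        (if j = i then 1 else 0) * pderiv j (fun z => U z i) x +
          x j * pderiv i (pderiv j fun z => U z i) x := by
      intro j
      rw [pderiv_mul (differentiable_euclideanCoord j) (hd i j), pderiv_euclideanCoord]
    simp_rw [e, Finset.sum_add_distrib]
    simp
  simp_rw [hterm, Finset.sum_add_distrib, h.sum_pderiv_comp_eq_zero x, zero_add]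
  rw [Finset.sum_comm]
  simp_rw [← Finset.mul_sum, h.sum_pderiv_pderiv_comp_eq_zero', mul_zero, Finset.sum_const_zero]

/-- `div ((U·∇)U) = Σᵢⱼ ∂ᵢUⱼ ∂ⱼUᵢ` for a Leray profile (`div U = 0`; Tsai 1998, (2.1):
`Σ ∂ᵢ∂ⱼ(UᵢUⱼ) = Σ ∂ᵢUⱼ∂ⱼUᵢ` for divergence-free `U`). [cite: Tsai1998, (2.1)] -/
theorem IsLerayProfile.sum_pderiv_convect_eq {ν a : ℝ} {U : 𝔼 → 𝔼} {P : 𝔼 → ℝ} (h : IsLerayProfile ν a U P) (x : 𝔼) :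
    ∑ i, pderiv i (fun y => ∑ j, U y j * pderiv j (fun z => U z i) y) x =
      ∑ i, ∑ j, pderiv i (fun z => U z j) x * pderiv j (fun z => U z i) x := by
  have hUc : ∀ i, ContDiff ℝ 2 (fun z => U z i) := fun i =>
    contDiff_comp_euclidean h.contDiff_velocity i
  have hUd : ∀ i, Differentiable ℝ (fun z => U z i) := fun i =>
    (hUc i).differentiable (by norm_num)
  have hd : ∀ i j, Differentiable ℝ (pderiv j fun z => U z i) := fun i j =>
    (contDiff_one_pderiv_of_contDiff_two (hUc i) j).differentiable one_ne_zero
  have hterm : ∀ i, pderiv i (fun y => ∑ j, U y j * pderiv j (fun z => U z i) y) x =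
      ∑ j, pderiv i (fun z => U z j) x * pderiv j (fun z => U z i) x +
        ∑ j, U x j * pderiv i (pderiv j fun z => U z i) x := by
    intro i
    rw [pderiv_sum Finset.univ (f := fun j y => U y j * pderiv j (fun z => U z i) y)
      fun j _ => (hUd j).mul (hd i j)]
    simp_rw [pderiv_mul (hUd _) (hd i _), Finset.sum_add_distrib]
  simp_rw [hterm, Finset.sum_add_distrib]
  conv_rhs => rw [← add_zero (∑ i, ∑ j, pderiv i (fun z => U z j) x * pderiv j (fun z => U z i) x)]
  congr 1
  rw [Finset.sum_comm]
  simp_rw [← Finset.mul_sum, h.sum_pderiv_pderiv_comp_eq_zero', mul_zero, Finset.sum_const_zero]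

omit [DecidableEq ι] in
/-- A continuous real function times a continuous compactly supported complex function is
integrable. [folklore] -/
theorem integrable_ofReal_mul {g : 𝔼 → ℝ} (hg : Continuous g) {φ : 𝔼 → ℂ} (hφ : Continuous φ)
    (hφs : HasCompactSupport φ) :
    Integrable (fun x => (g x : ℂ) * φ x) (volume : Measure 𝔼) :=
  ((Complex.continuous_ofReal.comp hg).mul hφ).integrable_of_hasCompactSupport hφs.mul_left

/-- **The viscous term is weakly divergence free**: for a Leray profile and every smooth
compactly supported `ψ`, `Σᵢ ∫ (Σⱼ ∂ⱼ∂ⱼUᵢ) ∂ᵢψ = 0` although `ΔU` is only continuous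
(`∫ ∂ⱼ∂ⱼUᵢ ∂ᵢψ = -∫ ∂ⱼUᵢ ∂ⱼ∂ᵢψ = -∫ ∂ⱼUᵢ ∂ᵢ∂ⱼψ = ∫ ∂ᵢ∂ⱼUᵢ ∂ⱼψ`, then
`Σᵢ ∂ᵢ∂ⱼUᵢ = 0`). [cite: Tsai1998, (2.1)] -/
theorem IsLerayProfile.sum_integral_laplacian_mul_fderiv_eq_zero {ν a : ℝ} {U : 𝔼 → 𝔼}
    {P : 𝔼 → ℝ} (h : IsLerayProfile ν a U P) {ψ : 𝔼 → ℂ} (hψ : ContDiff ℝ ∞ ψ)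
    (hψs : HasCompactSupport ψ) :
    ∑ i, ∫ x, ((∑ j, pderiv j (pderiv j fun z => U z i) x : ℝ) : ℂ) *
      fderiv ℝ ψ x (EuclideanSpace.basisFun ι ℝ i) = 0 := by
  set b := EuclideanSpace.basisFun ι ℝ with hbdef
  have hUc : ∀ i, ContDiff ℝ 2 (fun z => U z i) := fun i =>
    contDiff_comp_euclidean h.contDiff_velocity i
  have hd1 : ∀ i j, ContDiff ℝ 1 (pderiv j fun z => U z i) := fun i j =>
    contDiff_one_pderiv_of_contDiff_two (hUc i) j
  have hdd : ∀ i j, Differentiable ℝ (pderiv j fun z => U z i) := fun i j =>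
    (hd1 i j).differentiable one_ne_zero
  have hψ2 : ContDiff ℝ 2 ψ := hψ.of_le (by norm_cast)
  have hDψ : ∀ i, ContDiff ℝ ∞ (fun y => fderiv ℝ ψ y (b i)) := fun i =>
    (hψ.fderiv_right (m := ∞) (by norm_cast)).clm_apply contDiff_const
  have hDψ1 : ∀ i, ContDiff ℝ 1 (fun y => fderiv ℝ ψ y (b i)) := fun i =>
    (hDψ i).of_le (by exact_mod_cast le_top)
  have hDψs : ∀ i, HasCompactSupport (fun y => fderiv ℝ ψ y (b i)) := fun i =>
    hψs.fderiv_apply (𝕜 := ℝ) (b i)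
  -- one integration by parts per `(i, j)`
  have hij : ∀ i j, ∫ x, (pderiv j (pderiv j fun z => U z i) x : ℂ) * fderiv ℝ ψ x (b i) =
      -∫ x, (pderiv j (fun z => U z i) x : ℂ) *
        fderiv ℝ (fun y => fderiv ℝ ψ y (b j)) x (b i) := by
    intro i j
    have hibp := integral_mul_fderiv_apply_eq_neg (contDiff_ofReal_comp (hd1 i j)) (hDψ1 i)
      (hDψs i) (b j)
    have e1 : ∀ x, fderiv ℝ (fun y => (pderiv j (fun z => U z i) y : ℂ)) x (b j) =
        (pderiv j (pderiv j fun z => U z i) x : ℂ) := fun x => by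
      have := congrFun (fderiv_ofReal_comp_stdVec (hdd i j) j) x
      simpa only [hbdef] using this
    -- hibp : ∫ ↑(∂ⱼUᵢ) ∂ⱼ(∂ᵢψ) = -∫ ∂ⱼ↑(∂ⱼUᵢ) ∂ᵢψ
    have hsym : ∀ x, fderiv ℝ (fun y => fderiv ℝ ψ y (b i)) x (b j) =
        fderiv ℝ (fun y => fderiv ℝ ψ y (b j)) x (b i) := fun x =>
      fderiv_fderiv_comm_of_contDiff_two hψ2 (b i) (b j) x
    simp_rw [hsym] at hibp
    rw [hibp, neg_neg]
    refine integral_congr_ae (Filter.Eventually.of_forall fun x => ?_)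
    simp only [e1]
  -- expand the inner sum and integrate termwise
  have hI : ∀ i j, Integrable (fun x => (pderiv j (pderiv j fun z => U z i) x : ℂ) *
      fderiv ℝ ψ x (b i)) (volume : Measure 𝔼) := fun i j =>
    integrable_ofReal_mul (continuous_pderiv (hd1 i j) one_ne_zero j) (hDψ i).continuous (hDψs i)
  have hsplit : ∀ i, ∫ x, ((∑ j, pderiv j (pderiv j fun z => U z i) x : ℝ) : ℂ) *
      fderiv ℝ ψ x (b i) = ∑ j, ∫ x, (pderiv j (pderiv j fun z => U z i) x : ℂ) *
        fderiv ℝ ψ x (b i) := by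
    intro i
    rw [← integral_finsetSum _ fun j _ => hI i j]
    refine integral_congr_ae (Filter.Eventually.of_forall fun x => ?_)
    push_cast
    rw [Finset.sum_mul]
  simp_rw [hsplit, hij]
  rw [Finset.sum_comm]
  refine Finset.sum_eq_zero fun j _ => ?_
  rw [Finset.sum_neg_distrib, sum_integral_ofReal_mul_fderiv_eq (fun i => hd1 i j) (hDψ1 j) (hDψs j)]
  simp [h.sum_pderiv_pderiv_comp_eq_zero' j]

/-- **The weak pressure–Poisson equation of a Leray profile** (Tsai 1998, (2.1): "We take the
divergence of (1.3) and formally deduce that `-ΔP = Σ ∂ᵢ∂ⱼ(UᵢUⱼ)`"): for the tree's pointwise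
profile class (`U ∈ C²`, `P ∈ C¹`) and every smooth compactly supported complex `ψ`,
`∫ P Σᵢ∂ᵢ∂ᵢψ = -∫ (Σᵢⱼ ∂ᵢUⱼ ∂ⱼUᵢ) ψ`, i.e. `ΔP = -Σᵢⱼ ∂ᵢUⱼ∂ⱼUᵢ` in the sense of
distributions. [cite: Tsai1998, (2.1)] -/
theorem IsLerayProfile.integral_pressure_mul_laplacian {ν a : ℝ} {U : 𝔼 → 𝔼} {P : 𝔼 → ℝ}
    (h : IsLerayProfile ν a U P) (ψ : 𝔼 → ℂ) (hψ : ContDiff ℝ ∞ ψ)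
    (hψs : HasCompactSupport ψ) :
    ∫ x, (P x : ℂ) * ∑ i, fderiv ℝ (fun y => fderiv ℝ ψ y (EuclideanSpace.basisFun ι ℝ i)) x
        (EuclideanSpace.basisFun ι ℝ i) =
      ∫ x, ((-(∑ i, ∑ j, pderiv i (fun z => U z j) x * pderiv j (fun z => U z i) x) : ℝ) : ℂ) *
        ψ x := by
  set b := EuclideanSpace.basisFun ι ℝ with hbdef
  -- regularity bookkeeping
  have hUc : ∀ i, ContDiff ℝ 2 (fun z => U z i) := fun i =>
    contDiff_comp_euclidean h.contDiff_velocity i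
  have hU1 : ∀ i, ContDiff ℝ 1 (fun z => U z i) := fun i => (hUc i).of_le (by norm_num)
  have hd1 : ∀ i j, ContDiff ℝ 1 (pderiv j fun z => U z i) := fun i j =>
    contDiff_one_pderiv_of_contDiff_two (hUc i) j
  have hP1 : ContDiff ℝ 1 P := h.contDiff_pressure
  have hPd : Differentiable ℝ P := hP1.differentiable one_ne_zero
  have hDψ : ∀ i, ContDiff ℝ ∞ (fun y => fderiv ℝ ψ y (b i)) := fun i =>
    (hψ.fderiv_right (m := ∞) (by norm_cast)).clm_apply contDiff_const
  have hDψ1 : ∀ i, ContDiff ℝ 1 (fun y => fderiv ℝ ψ y (b i)) := fun i =>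
    (hDψ i).of_le (by exact_mod_cast le_top)
  have hDψs : ∀ i, HasCompactSupport (fun y => fderiv ℝ ψ y (b i)) := fun i =>
    hψs.fderiv_apply (𝕜 := ℝ) (b i)
  have hψ1 : ContDiff ℝ 1 ψ := hψ.of_le (by exact_mod_cast le_top)
  -- the nonlinear and drift fields
  set L : ι → 𝔼 → ℝ := fun i x => ∑ j, pderiv j (pderiv j fun z => U z i) x with hLdef
  set N₁ : ι → 𝔼 → ℝ := fun i x => ∑ j, U x j * pderiv j (fun z => U z i) x with hN₁def
  set N₂ : ι → 𝔼 → ℝ := fun i x => ∑ j, x j * pderiv j (fun z => U z i) x with hN₂def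
  have hLc : ∀ i, Continuous (L i) := fun i =>
    continuous_finsetSum _ fun j _ => continuous_pderiv (hd1 i j) one_ne_zero j
  have hN₁1 : ∀ i, ContDiff ℝ 1 (N₁ i) := fun i =>
    ContDiff.sum fun j _ => (hU1 j).mul (hd1 i j)
  have hN₂1 : ∀ i, ContDiff ℝ 1 (N₂ i) := fun i =>
    ContDiff.sum fun j _ => (contDiff_euclideanCoord j).mul (hd1 i j)
  -- Step 1: move one derivative onto `P`
  have hstep1 : ∫ x, (P x : ℂ) * ∑ i, fderiv ℝ (fun y => fderiv ℝ ψ y (b i)) x (b i) =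
      -∑ i, ∫ x, (pderiv i P x : ℂ) * fderiv ℝ ψ x (b i) := by
    have hI : ∀ i, Integrable (fun x => (P x : ℂ) * fderiv ℝ (fun y => fderiv ℝ ψ y (b i)) x (b i))
        (volume : Measure 𝔼) := fun i =>
      integrable_ofReal_mul hP1.continuous (((hDψ i).fderiv_right (m := ∞)
        (by norm_cast)).clm_apply contDiff_const).continuous ((hDψs i).fderiv_apply (𝕜 := ℝ) (b i))
    simp_rw [Finset.mul_sum]
    rw [integral_finsetSum _ fun i _ => hI i, ← Finset.sum_neg_distrib]
    refine Finset.sum_congr rfl fun i _ => ?_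
    rw [integral_mul_fderiv_apply_eq_neg (contDiff_ofReal_comp hP1) (hDψ1 i) (hDψs i) (b i)]
    congr 1
    refine integral_congr_ae (Filter.Eventually.of_forall fun x => ?_)
    have e := congrFun (fderiv_ofReal_comp_stdVec hPd i) x
    simp only [← hbdef] at e
    simp only [e]
  -- Step 2: the pressure gradient from the profile equation
  have hreal : ∀ i x, pderiv i P x = ν * L i x - a * U x i - N₁ i x - a * N₂ i x := by
    intro i x
    rw [h.pderiv_pressure_eq i]
    simp only [hLdef, hN₁def, hN₂def, add_mul, Finset.sum_add_distrib, mul_assoc,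
      ← Finset.mul_sum]
    ring
  have hgradP : ∀ i x, (pderiv i P x : ℂ) =
      ν * (L i x : ℂ) - a * (U x i : ℂ) - (N₁ i x : ℂ) - a * (N₂ i x : ℂ) := by
    intro i x
    rw [hreal]
    push_cast
    ring
  have hIL : ∀ i, Integrable (fun x => (L i x : ℂ) * fderiv ℝ ψ x (b i)) (volume : Measure 𝔼) :=
    fun i => integrable_ofReal_mul (hLc i) (hDψ i).continuous (hDψs i)
  have hIU : ∀ i, Integrable (fun x => (U x i : ℂ) * fderiv ℝ ψ x (b i)) (volume : Measure 𝔼) :=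
    fun i => integrable_ofReal_mul (hU1 i).continuous (hDψ i).continuous (hDψs i)
  have hIN₁ : ∀ i, Integrable (fun x => (N₁ i x : ℂ) * fderiv ℝ ψ x (b i)) (volume : Measure 𝔼) :=
    fun i => integrable_ofReal_mul (hN₁1 i).continuous (hDψ i).continuous (hDψs i)
  have hIN₂ : ∀ i, Integrable (fun x => (N₂ i x : ℂ) * fderiv ℝ ψ x (b i)) (volume : Measure 𝔼) :=
    fun i => integrable_ofReal_mul (hN₂1 i).continuous (hDψ i).continuous (hDψs i)
  have hstep2 : ∀ i, ∫ x, (pderiv i P x : ℂ) * fderiv ℝ ψ x (b i) =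
      ν * (∫ x, (L i x : ℂ) * fderiv ℝ ψ x (b i)) - a * (∫ x, (U x i : ℂ) * fderiv ℝ ψ x (b i)) -
        (∫ x, (N₁ i x : ℂ) * fderiv ℝ ψ x (b i)) - a * ∫ x, (N₂ i x : ℂ) * fderiv ℝ ψ x (b i) := by
    intro i
    have hX1a : Integrable (fun x => (ν : ℂ) * ((L i x : ℂ) * fderiv ℝ ψ x (b i)))
        (volume : Measure 𝔼) := (hIL i).const_mul _
    have hX1b : Integrable (fun x => (a : ℂ) * ((U x i : ℂ) * fderiv ℝ ψ x (b i)))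
        (volume : Measure 𝔼) := (hIU i).const_mul _
    have hX4 : Integrable (fun x => (a : ℂ) * ((N₂ i x : ℂ) * fderiv ℝ ψ x (b i)))
        (volume : Measure 𝔼) := (hIN₂ i).const_mul _
    have hX2 : Integrable (fun x => (ν : ℂ) * ((L i x : ℂ) * fderiv ℝ ψ x (b i)) -
        (a : ℂ) * ((U x i : ℂ) * fderiv ℝ ψ x (b i))) (volume : Measure 𝔼) := hX1a.sub hX1b
    have hX3 : Integrable (fun x => (ν : ℂ) * ((L i x : ℂ) * fderiv ℝ ψ x (b i)) -
        (a : ℂ) * ((U x i : ℂ) * fderiv ℝ ψ x (b i)) - (N₁ i x : ℂ) * fderiv ℝ ψ x (b i))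
        (volume : Measure 𝔼) := hX2.sub (hIN₁ i)
    calc ∫ x, (pderiv i P x : ℂ) * fderiv ℝ ψ x (b i)
        = ∫ x, ((ν : ℂ) * ((L i x : ℂ) * fderiv ℝ ψ x (b i)) -
            (a : ℂ) * ((U x i : ℂ) * fderiv ℝ ψ x (b i)) - (N₁ i x : ℂ) * fderiv ℝ ψ x (b i) -
            (a : ℂ) * ((N₂ i x : ℂ) * fderiv ℝ ψ x (b i))) := by
          refine integral_congr_ae (Filter.Eventually.of_forall fun x => ?_)
          simp only [hgradP]
          ring
      _ = _ := by
          rw [integral_sub hX3 hX4, integral_sub hX2 (hIN₁ i), integral_sub hX1a hX1b,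
            integral_const_mul, integral_const_mul, integral_const_mul]
  -- Step 3: the four sums
  have hT1 : ∑ i, ∫ x, (L i x : ℂ) * fderiv ℝ ψ x (b i) = 0 :=
    h.sum_integral_laplacian_mul_fderiv_eq_zero hψ hψs
  have hT2 : ∑ i, ∫ x, (U x i : ℂ) * fderiv ℝ ψ x (b i) = 0 := by
    rw [sum_integral_ofReal_mul_fderiv_eq (fun i => hU1 i) hψ1 hψs]
    simp [h.sum_pderiv_comp_eq_zero]
  have hT3 : ∑ i, ∫ x, (N₂ i x : ℂ) * fderiv ℝ ψ x (b i) = 0 := by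
    rw [sum_integral_ofReal_mul_fderiv_eq (fun i => hN₂1 i) hψ1 hψs]
    simp [hN₂def, h.sum_pderiv_drift_eq_zero]
  have hT4 : ∑ i, ∫ x, (N₁ i x : ℂ) * fderiv ℝ ψ x (b i) =
      -∫ x, ((∑ i, ∑ j, pderiv i (fun z => U z j) x * pderiv j (fun z => U z i) x : ℝ) : ℂ) *
        ψ x := by
    rw [sum_integral_ofReal_mul_fderiv_eq (fun i => hN₁1 i) hψ1 hψs]
    simp only [hN₁def, h.sum_pderiv_convect_eq]
  -- assemble
  rw [hstep1]
  simp_rw [hstep2]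
  rw [Finset.sum_sub_distrib, Finset.sum_sub_distrib, Finset.sum_sub_distrib, ← Finset.mul_sum,
    ← Finset.mul_sum, ← Finset.mul_sum, hT1, hT2, hT3, hT4]
  simp only [mul_zero, sub_zero, zero_sub, neg_neg]
  rw [← integral_neg]
  refine integral_congr_ae (Filter.Eventually.of_forall fun x => ?_)
  push_cast
  ring

end Literature.Analysis.FluidPDE
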